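import Literature.Computability.QuantumComplexity.HidingSamplerNumerics
import Literature.Computability.QuantumComplexity.HidingRealToIdeal
import HarnessLib

/-!
# The proof of AA13 Thm. 1.3: the error budget at the machine's parameters

Family `quantum-advantage`, sequel of `HidingSamplerNumerics.lean`. The thresholds of the union
bound of the discharge of Aaronson–Arkhipov's Thm. 1.3 at the machine's parameters (`N = n + kε + kδ`,
`ε = 1/kε`, `δ = 1/kδ`, standing hypotheses `HidingHyp`): `gramTol` `t = 1/(65536 N⁵)` (Gram
tolerance), `perThr` `P = 4√W` and `pertThr` `Z = 128 t n³ √W` with `markovW` `W = sⁿ n! kδ`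
(Markov thresholds of the planted permanent and of the perturbation sum; `entryMoment`
`s = 2·4ᵇ·v`), `oracleEps` `ε₀ = 1/(32N)` and `oracleDelta` `δ₀ = δ/4` (the oracle's accuracy
split), and the resulting NUMBERS (namespace `HidingHyp`):

* `fractions_le` — the six fractions of `card_not_idealGood_le` sum to `≤ 6δ/16`;
* `errTerm_le` — the error term of the good event is `≤ n!/(2kε)` (eqs. (5.93)–(5.95));
* `inv_kβ_le` — the oracle's `1/kβ ≤ ε₀δ₀/24`;
* the real-side tails `entry_tail_le`, `range_tail_le` (`≤ δ/16` each) and the rounding of the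
  permanent `rounding_le` (`≤ n!/(2kε)`);
* the side conditions `side_conditions`.

All proved, no new named facts.

## References

* S. Aaronson, A. Arkhipov, *The computational complexity of linear optics*, Theory of Computing 9
  (2013) 143–252, proof of Thm. 1.3, eqs. (5.85)–(5.97) (pp. 194–195).
-/

noncomputable section

namespace Literature.Computability.QuantumComplexity

open Real Polynomial Finset Literature.Computability.Complexity Literature.Probability.Distributions

/-! ### The thresholds -/

/-- The Gram tolerance `t = 1/(65536 N⁵)`. [folklore] -/
def gramTol (N : ℕ) : ℝ := 1 / (65536 * (N : ℝ) ^ 5)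

/-- The entries' second moment `s = 2 · 4ᵇ · v`. [folklore] -/
def entryMoment (N : ℕ) : ℝ := 2 * 4 ^ (sP N).b * (sP N).v

/-- `W = sⁿ n! kδ`. [folklore] -/
def markovW (n N kδ : ℕ) : ℝ := entryMoment N ^ n * n.factorial * kδ

/-- The planted-permanent threshold `P = 4√W` (`P² = 16 sⁿ n! kδ`). [folklore] -/
def perThr (n N kδ : ℕ) : ℝ := 4 * √(markovW n N kδ)

/-- The perturbation threshold `Z = 128 t n³ √W`. [folklore] -/
def pertThr (n N kδ : ℕ) : ℝ := 128 * gramTol N * (n : ℝ) ^ 3 * √(markovW n N kδ)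

/-- The oracle's accuracy split `ε₀ = 1/(32N)`. [folklore] -/
def oracleEps (N : ℕ) : ℝ := 1 / (32 * (N : ℝ))

/-- The oracle's accuracy split `δ₀ = 1/(4kδ)`. [folklore] -/
def oracleDelta (kδ : ℕ) : ℝ := 1 / (4 * (kδ : ℝ))

variable {n kε kδ N : ℕ}

/-- The standing hypotheses: `1 ≤ n`, `1 ≤ kε`, `1 ≤ kδ`, `N = n + kε + kδ`. [folklore] -/
structure HidingHyp (n kε kδ N : ℕ) : Prop where
  /-- the dimension is positive -/
  hn : 1 ≤ n
  /-- `ε = 1/kε` with `kε ≥ 1` -/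
  hε : 1 ≤ kε
  /-- `δ = 1/kδ` with `kδ ≥ 1` -/
  hδ : 1 ≤ kδ
  /-- `N = n + kε + kδ` -/
  hN : n + kε + kδ = N

/-- `m > 2⁵⁵(N+1)¹⁵` as reals, and `m > 0`. [folklore] -/
theorem hidH_m_real_lower (N : ℕ) : (2 : ℝ) ^ 55 * ((N : ℝ) + 1) ^ 15 < (hidH.m N : ℕ) ∧ (0 : ℝ) < (hidH.m N : ℕ) := by
  have hM := (hidH_m_bounds N).1
  have h1 : (2 : ℝ) ^ 55 * ((N : ℝ) + 1) ^ 15 < (hidH.m N : ℕ) := by exact_mod_cast hM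
  exact ⟨h1, lt_of_le_of_lt (by positivity) h1⟩

namespace HidingHyp

variable (H : HidingHyp n kε kδ N)
include H

/-- `3 ≤ N`. [folklore] -/
theorem three_le_N : 3 ≤ N := by have := H.hn; have := H.hε; have := H.hδ; have := H.hN; omega
/-- `n ≤ N`. [folklore] -/
theorem n_le_N : n ≤ N := by have := H.hN; omega
/-- `kε ≤ N`. [folklore] -/
theorem kε_le_N : kε ≤ N := by have := H.hN; omega
/-- `kδ ≤ N`. [folklore] -/
theorem kδ_le_N : kδ ≤ N := by have := H.hN; omega
/-- `0 < n` (reals). [folklore] -/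
theorem n_pos_real : (0 : ℝ) < n := by have := H.hn; exact_mod_cast this
/-- `1 ≤ N` (reals). [folklore] -/
theorem N_real : (1 : ℝ) ≤ N := by exact_mod_cast (show 1 ≤ N by have := H.three_le_N; omega)
/-- `n ≤ N` (reals). [folklore] -/
theorem n_le_N_real : (n : ℝ) ≤ N := by have := H.n_le_N; exact_mod_cast this
/-- `1 ≤ kε` (reals). [folklore] -/
theorem kε_real : (1 : ℝ) ≤ kε := by have := H.hε; exact_mod_cast this
/-- `1 ≤ kδ` (reals). [folklore] -/
theorem kδ_real : (1 : ℝ) ≤ kδ := by have := H.hδ; exact_mod_cast this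
/-- `kε ≤ N` (reals). [folklore] -/
theorem kε_le_N_real : (kε : ℝ) ≤ N := by have := H.kε_le_N; exact_mod_cast this
/-- `kδ ≤ N` (reals). [folklore] -/
theorem kδ_le_N_real : (kδ : ℝ) ≤ N := by have := H.kδ_le_N; exact_mod_cast this

/-! ### Positivity and the side conditions -/

/-- `0 < t`. [folklore] -/
theorem t_pos : 0 < gramTol N := by unfold gramTol; have := H.N_real; positivity

/-- `t N⁵ = 1/65536`. [folklore] -/
theorem t_le : gramTol N * (N : ℝ) ^ 5 = 1 / 65536 := by
  unfold gramTol; have := H.N_real; field_simp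

/-- `0 < s`. [folklore] -/
theorem s_pos : 0 < entryMoment N := (sP_s_bounds (show 1 ≤ N by have := H.three_le_N; omega)).1

/-- `4ᵇ/200 ≤ s`. [folklore] -/
theorem s_ge : (4 : ℝ) ^ (sP N).b / 200 ≤ entryMoment N := (sP_s_bounds (show 1 ≤ N by have := H.three_le_N; omega)).2

/-- `(s/4ᵇ)ⁿ = (2v)ⁿ ≤ 3`. [folklore] -/
theorem s_div_pow_le : (entryMoment N / 4 ^ (sP N).b) ^ n ≤ 3 := by
  have h := pow_two_v_le_three H.hn H.n_le_N
  have : entryMoment N / 4 ^ (sP N).b = 2 * (sP N).v := by unfold entryMoment; field_simp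
  rw [this]; exact h

/-- `0 < W`. [folklore] -/
theorem W_pos : 0 < markovW n N kδ := by
  unfold markovW; have := H.s_pos; have := H.kδ_real; positivity

/-- `0 < P`. [folklore] -/
theorem Pr_pos : 0 < perThr n N kδ := by unfold perThr; have := H.W_pos; positivity

/-- `0 < Z`. [folklore] -/
theorem Z_pos : 0 < pertThr n N kδ := by unfold pertThr; have := H.W_pos; have := H.t_pos; have := H.n_pos_real; positivity

/-- `P² = 16 W`. [folklore] -/
theorem Pr_sq : perThr n N kδ ^ 2 = 16 * markovW n N kδ := by
  unfold perThr; rw [mul_pow, Real.sq_sqrt H.W_pos.le]; norm_num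

/-- `Z² = 16384 t² n⁶ W`. [folklore] -/
theorem Z_sq : pertThr n N kδ ^ 2 = 16384 * gramTol N ^ 2 * (n : ℝ) ^ 6 * markovW n N kδ := by
  unfold pertThr; rw [mul_pow, mul_pow, mul_pow, Real.sq_sqrt H.W_pos.le]; ring

/-- `t n³ ≤ 1/65536` (so `8tn ≤ 1`, `8tn³ ≤ 1`, `tn < 1`, `t ≤ 1/4`, `Z ≤ P`). [folklore] -/
theorem t_mul_cube_le : gramTol N * (n : ℝ) ^ 3 ≤ 1 / 65536 := by
  have h1 := H.t_le
  have hn := H.n_le_N_real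
  have hn0 := H.n_pos_real
  have hN := H.N_real
  have : (n : ℝ) ^ 3 ≤ (N : ℝ) ^ 5 := by
    calc (n : ℝ) ^ 3 ≤ (N : ℝ) ^ 3 := by gcongr
      _ ≤ (N : ℝ) ^ 5 := pow_le_pow_right₀ hN (by norm_num)
  calc gramTol N * (n : ℝ) ^ 3 ≤ gramTol N * (N : ℝ) ^ 5 := mul_le_mul_of_nonneg_left this H.t_pos.le
    _ = 1 / 65536 := h1

/-- **The side conditions of `card_fail_le`.** [folklore] -/
theorem side_conditions : 8 * gramTol N * n ≤ 1 ∧ gramTol N ≤ 1 / 4 ∧ gramTol N * n < 1 ∧ 8 * gramTol N * (n : ℝ) ^ 3 ≤ 1 ∧ pertThr n N kδ ≤ perThr n N kδ := by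
  have h := H.t_mul_cube_le
  have ht := H.t_pos
  have hn1 : (1 : ℝ) ≤ n := by have := H.hn; exact_mod_cast this
  have hn3 : (n : ℝ) ≤ (n : ℝ) ^ 3 := le_self_pow₀ hn1 (by norm_num)
  have h1 : gramTol N * n ≤ 1 / 65536 := (mul_le_mul_of_nonneg_left hn3 ht.le).trans h
  have h0 : gramTol N ≤ 1 / 65536 := by
    calc gramTol N = gramTol N * 1 := (mul_one _).symm
      _ ≤ gramTol N * n := mul_le_mul_of_nonneg_left hn1 ht.le
      _ ≤ 1 / 65536 := h1
  refine ⟨by linarith only [h1], by linarith only [h0], by linarith only [h1], by linarith only [h], ?_⟩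
  unfold pertThr perThr
  have hW : 0 ≤ √(markovW n N kδ) := Real.sqrt_nonneg _
  have := mul_le_mul_of_nonneg_right h hW
  nlinarith only [this, hW]

/-! ### The six fractions -/

/-- **The Gram fraction is at most `δ/16`** (with `M₄ ≤ 2T² s`): `n²·4m(M₄+s²)/(tms)² ≤ 4n²K/(t²m)`,
`K = 102400(N+1)² + 1`, and `64 n² K kδ · 65536² N¹⁰ ≤ 2⁵⁵(N+1)¹⁵ < m`. [folklore] -/
theorem gram_fraction_le {M4 : ℝ} (hM4 : M4 ≤ 2 * ((sP N).T : ℝ) ^ 2 * entryMoment N) :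
    (n : ℝ) ^ 2 * (4 * (hidH.m N : ℕ) * (M4 + entryMoment N ^ 2)) / (gramTol N * ((hidH.m N : ℕ) * entryMoment N)) ^ 2 ≤ 1 / (16 * (kδ : ℝ)) := by
  have hN := H.N_real
  have hkδ := H.kδ_real
  have hkδN := H.kδ_le_N_real
  have hnN := H.n_le_N_real
  have hn0 := H.n_pos_real
  have hs := H.s_pos
  have ht := H.t_pos
  obtain ⟨hMr, hMpos⟩ := hidH_m_real_lower N
  set M : ℝ := ((hidH.m N : ℕ) : ℝ) with hMdef
  set K : ℝ := 102400 * ((N : ℝ) + 1) ^ 2 + 1 with hK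
  have hK0 : 0 < K := by positivity
  -- `M4 + s² ≤ K s²`
  have hT : ((sP N).T : ℝ) = (sP N).R * 2 ^ (sP N).b := by
    have h := (sP N).T_mul_h
    have h2 : (0 : ℝ) < 2 ^ (sP N).b := by positivity
    unfold PGParams.h at h
    rw [← h, mul_assoc, inv_mul_cancel₀ h2.ne', mul_one]
  have hR := sP_R_le N
  have hR0 : 0 ≤ (sP N).R := by unfold PGParams.R; positivity
  have hsge := H.s_ge
  have hT2 : 2 * ((sP N).T : ℝ) ^ 2 ≤ 102400 * ((N : ℝ) + 1) ^ 2 * entryMoment N := by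
    have h2sq : ((2 : ℝ) ^ (sP N).b) ^ 2 = 4 ^ (sP N).b := by
      rw [← pow_mul, mul_comm, pow_mul]; norm_num
    rw [hT, mul_pow, h2sq]
    have hR2 : (sP N).R ^ 2 ≤ 256 * ((N : ℝ) + 1) ^ 2 := by
      calc (sP N).R ^ 2 ≤ (16 * ((N : ℝ) + 1)) ^ 2 := pow_le_pow_left₀ hR0 hR 2
        _ = 256 * ((N : ℝ) + 1) ^ 2 := by ring
    have h4 : (0 : ℝ) ≤ 4 ^ (sP N).b := by positivity
    calc 2 * ((sP N).R ^ 2 * 4 ^ (sP N).b) ≤ 2 * (256 * ((N : ℝ) + 1) ^ 2 * 4 ^ (sP N).b) := by gcongr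
      _ = 102400 * ((N : ℝ) + 1) ^ 2 * (4 ^ (sP N).b / 200) := by ring
      _ ≤ 102400 * ((N : ℝ) + 1) ^ 2 * entryMoment N := by gcongr
  have hKs : M4 + entryMoment N ^ 2 ≤ K * entryMoment N ^ 2 := by
    have : M4 ≤ 102400 * ((N : ℝ) + 1) ^ 2 * entryMoment N * entryMoment N :=
      hM4.trans (mul_le_mul_of_nonneg_right hT2 hs.le)
    rw [hK]; linarith only [this]
  -- step 1: `≤ 4 n² K/(t² M)`
  have hstep1 : (n : ℝ) ^ 2 * (4 * M * (M4 + entryMoment N ^ 2)) / (gramTol N * (M * entryMoment N)) ^ 2 ≤ 4 * (n : ℝ) ^ 2 * K / (gramTol N ^ 2 * M) := by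
    calc (n : ℝ) ^ 2 * (4 * M * (M4 + entryMoment N ^ 2)) / (gramTol N * (M * entryMoment N)) ^ 2
        ≤ (n : ℝ) ^ 2 * (4 * M * (K * entryMoment N ^ 2)) / (gramTol N * (M * entryMoment N)) ^ 2 := by
          gcongr
      _ = 4 * (n : ℝ) ^ 2 * K / (gramTol N ^ 2 * M) := by
          rw [div_eq_div_iff (by positivity) (by positivity)]
          ring
  refine hstep1.trans ?_
  -- step 2: `64 n² K kδ ≤ t² M`
  have ht2M : gramTol N ^ 2 * M = M / (65536 ^ 2 * (N : ℝ) ^ 10) := by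
    unfold gramTol; rw [eq_div_iff (by positivity)]; field_simp
  rw [div_le_div_iff₀ (by positivity) (by positivity), one_mul, ht2M, le_div_iff₀ (by positivity)]
  have hK' : K ≤ 131072 * ((N : ℝ) + 1) ^ 2 := by
    have : (1 : ℝ) ≤ ((N : ℝ) + 1) ^ 2 := by nlinarith only [hN]
    rw [hK]; linarith only [this]
  calc 4 * (n : ℝ) ^ 2 * K * (16 * kδ) * (65536 ^ 2 * (N : ℝ) ^ 10)
      ≤ 4 * (N : ℝ) ^ 2 * (131072 * ((N : ℝ) + 1) ^ 2) * (16 * N) * (65536 ^ 2 * (N : ℝ) ^ 10) := by gcongr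
    _ = 2 ^ 55 * ((N : ℝ) ^ 13 * ((N : ℝ) + 1) ^ 2) := by ring
    _ ≤ 2 ^ 55 * (((N : ℝ) + 1) ^ 13 * ((N : ℝ) + 1) ^ 2) := by gcongr; linarith
    _ = 2 ^ 55 * ((N : ℝ) + 1) ^ 15 := by ring
    _ ≤ M := hMr.le

/-- **The six fractions of the union bound sum to at most `6δ/16`** (with `M₄ ≤ 2T² s`).
[cite: AaronsonArkhipovToC2013, proof of Thm. 1.3, eq. (5.95) (p. 195)] -/
theorem fractions_le {M4 : ℝ} (hM4 : M4 ≤ 2 * ((sP N).T : ℝ) ^ 2 * entryMoment N) :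
    (n : ℝ) ^ 2 / (hidH.m N : ℕ) +
        (n : ℝ) ^ 2 * (4 * (hidH.m N : ℕ) * (M4 + entryMoment N ^ 2)) / (gramTol N * ((hidH.m N : ℕ) * entryMoment N)) ^ 2 +
        4 * (8 * gramTol N) ^ 2 * (n : ℝ) ^ 6 * (entryMoment N ^ n * n.factorial) / pertThr n N kδ ^ 2 +
        entryMoment N ^ n * n.factorial / perThr n N kδ ^ 2 + oracleDelta kδ / 4 + 1 / (hidH.kδS N : ℝ) ≤ 6 / (16 * (kδ : ℝ)) := by
  have hN := H.N_real
  have hkδ := H.kδ_real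
  have hkδN := H.kδ_le_N_real
  have hnN := H.n_le_N_real
  have hn0 := H.n_pos_real
  have hs := H.s_pos
  have ht := H.t_pos
  have hW := H.W_pos
  have hnf : (0 : ℝ) < n.factorial := by exact_mod_cast Nat.factorial_pos n
  obtain ⟨hMr, hMpos⟩ := hidH_m_real_lower N
  -- f1: `n²/M ≤ 1/(16kδ)`
  have f1 : (n : ℝ) ^ 2 / (hidH.m N : ℕ) ≤ 1 / (16 * (kδ : ℝ)) := by
    rw [div_le_div_iff₀ hMpos (by positivity)]
    have h2 : 16 * (N : ℝ) ^ 3 ≤ (hidH.m N : ℕ) := by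
      refine le_trans ?_ hMr.le
      have : (N : ℝ) ^ 3 ≤ ((N : ℝ) + 1) ^ 15 := by
        calc (N : ℝ) ^ 3 ≤ ((N : ℝ) + 1) ^ 3 := by gcongr; linarith
          _ ≤ ((N : ℝ) + 1) ^ 15 := pow_le_pow_right₀ (by linarith) (by norm_num)
      calc 16 * (N : ℝ) ^ 3 ≤ 16 * ((N : ℝ) + 1) ^ 15 := by gcongr
        _ ≤ 2 ^ 55 * ((N : ℝ) + 1) ^ 15 := by gcongr; norm_num
    calc (n : ℝ) ^ 2 * (16 * kδ) ≤ (N : ℝ) ^ 2 * (16 * N) := by gcongr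
      _ = 16 * (N : ℝ) ^ 3 := by ring
      _ ≤ 1 * (hidH.m N : ℕ) := by rw [one_mul]; exact h2
  have f2 := H.gram_fraction_le hM4
  -- f3: the perturbation fraction `= 1/(64 kδ)`
  have f3 : 4 * (8 * gramTol N) ^ 2 * (n : ℝ) ^ 6 * (entryMoment N ^ n * n.factorial) / pertThr n N kδ ^ 2 = 1 / (64 * (kδ : ℝ)) := by
    rw [H.Z_sq, markovW, div_eq_div_iff (by positivity) (by positivity)]
    ring
  -- f4: the permanent fraction `= 1/(16 kδ)`
  have f4 : entryMoment N ^ n * n.factorial / perThr n N kδ ^ 2 = 1 / (16 * (kδ : ℝ)) := by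
    rw [H.Pr_sq, markovW, div_eq_div_iff (by positivity) (by positivity)]
    ring
  -- f5, f6
  have f5 : oracleDelta kδ / 4 = 1 / (16 * (kδ : ℝ)) := by
    unfold oracleDelta; rw [div_div, div_eq_div_iff (by positivity) (by positivity)]; ring
  have f6 : 1 / (hidH.kδS N : ℝ) ≤ 1 / (16 * (kδ : ℝ)) := by
    rw [hidH_kδS]; push_cast
    exact div_le_div_of_nonneg_left (by norm_num) (by positivity) (by linarith only [hkδN])
  have h64 : 1 / (64 * (kδ : ℝ)) ≤ 1 / (16 * (kδ : ℝ)) :=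
    div_le_div_of_nonneg_left (by norm_num) (by positivity) (by linarith only [hkδ])
  rw [f3, f4, f5]
  have : 6 / (16 * (kδ : ℝ)) = 6 * (1 / (16 * (kδ : ℝ))) := by ring
  rw [this]
  linarith only [f1, f2, f6, h64]

/-! ### The error term -/

/-- `(1 + t)ⁿ ≤ 2`. [folklore] -/
theorem one_add_t_pow_le : (1 + gramTol N) ^ n ≤ 2 := by
  have ht := H.t_pos
  have h1 := H.side_conditions.1
  calc (1 + gramTol N) ^ n ≤ (exp (gramTol N)) ^ n := pow_le_pow_left₀ (by linarith) (by have := Real.add_one_le_exp (gramTol N); linarith) n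
    _ = exp (n * gramTol N) := by rw [← Real.exp_nat_mul]
    _ ≤ exp (1 / 2) := Real.exp_le_exp.2 (by have : (n : ℝ) * gramTol N = gramTol N * n := mul_comm _ _; linarith only [h1, this])
    _ ≤ 2 := by
        have h := Real.abs_exp_sub_one_sub_id_le (x := 1 / 2) (by rw [abs_of_pos (by norm_num)]; norm_num)
        have := (abs_le.1 h).2
        linarith only [this]

/-- `t n³ kδ ≤ 1/(65536 N)`. [folklore] -/
theorem t_cube_kδ_le : gramTol N * (n : ℝ) ^ 3 * kδ ≤ 1 / (65536 * (N : ℝ)) := by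
  have hN := H.N_real
  have hnN := H.n_le_N_real
  have hkδN := H.kδ_le_N_real
  have hn0 := H.n_pos_real
  have hkδ := H.kδ_real
  have hprod : (n : ℝ) ^ 3 * kδ ≤ (N : ℝ) ^ 3 * N := by
    have h1 : (n : ℝ) ^ 3 ≤ (N : ℝ) ^ 3 := by gcongr
    exact mul_le_mul h1 hkδN (by positivity) (by positivity)
  unfold gramTol
  rw [mul_assoc, div_mul_eq_mul_div, one_mul, div_le_div_iff₀ (by positivity) (by positivity), one_mul]
  calc (n : ℝ) ^ 3 * kδ * (65536 * N) = 65536 * ((n : ℝ) ^ 3 * kδ * N) := by ring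
    _ ≤ 65536 * ((N : ℝ) ^ 3 * N * N) := by gcongr
    _ = 65536 * (N : ℝ) ^ 5 := by ring

/-- **The error term of the good event is at most `n!/(2kε)`** (eqs. (5.93)–(5.95) with the
thresholds above: each of the four pieces is `≤ n!/(8N) ≤ n!/(8kε)`). [cite: AaronsonArkhipovToC2013, proof of Thm. 1.3, eqs. (5.93)–(5.95) (p. 195)] -/
theorem errTerm_le : errTerm (sP N) n (hidH.m N) (hidH.kη N) (gramTol N) (pertThr n N kδ) (perThr n N kδ) (oracleEps N) ≤
    (n.factorial : ℝ) / (2 * kε) := by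
  have hN := H.N_real
  have hkε := H.kε_real
  have hkεN := H.kε_le_N_real
  have hkδ := H.kδ_real
  have hkδN := H.kδ_le_N_real
  have hn0 := H.n_pos_real
  have hs := H.s_pos
  have ht := H.t_pos
  have hW := H.W_pos
  have hPr := H.Pr_pos
  have hZ := H.Z_pos
  have hZP := H.side_conditions.2.2.2.2
  have h4b : (0 : ℝ) < 4 ^ (sP N).b := by positivity
  have h4bn : (0 : ℝ) < 4 ^ ((sP N).b * n) := by positivity
  have hnf : (0 : ℝ) < n.factorial := by exact_mod_cast Nat.factorial_pos n
  have hnf1 : (1 : ℝ) ≤ n.factorial := by exact_mod_cast Nat.factorial_pos n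
  obtain ⟨hMr, hMpos⟩ := hidH_m_real_lower N
  have hkη : ((hidH.kη N : ℕ) : ℝ) = 512 * (N : ℝ) ^ 2 := by rw [hidH_kη]; push_cast; ring
  -- the unit `U = n! 4^{bn}` and `W ≤ 3 kδ U`
  set U : ℝ := (n.factorial : ℝ) * 4 ^ ((sP N).b * n) with hU
  have hU0 : 0 < U := by positivity
  have hsn : entryMoment N ^ n ≤ 3 * 4 ^ ((sP N).b * n) := by
    have h := H.s_div_pow_le
    rw [div_pow, div_le_iff₀ (by positivity), ← pow_mul] at h
    exact h
  have hWle : markovW n N kδ ≤ 3 * kδ * U := by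
    unfold markovW
    calc entryMoment N ^ n * n.factorial * kδ ≤ 3 * 4 ^ ((sP N).b * n) * n.factorial * kδ := by gcongr
      _ = 3 * kδ * U := by rw [hU]; ring
  -- A: `(2P+Z)Z ≤ 3PZ = 1536 t n³ W ≤ (9/128) U/N`
  have hPZ : perThr n N kδ * pertThr n N kδ = 512 * gramTol N * (n : ℝ) ^ 3 * markovW n N kδ := by
    unfold perThr pertThr
    have := Real.mul_self_sqrt hW.le
    calc 4 * √(markovW n N kδ) * (128 * gramTol N * (n : ℝ) ^ 3 * √(markovW n N kδ))
        = 512 * gramTol N * (n : ℝ) ^ 3 * (√(markovW n N kδ) * √(markovW n N kδ)) := by ring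
      _ = 512 * gramTol N * (n : ℝ) ^ 3 * markovW n N kδ := by rw [this]
  have hA : (2 * perThr n N kδ + pertThr n N kδ) * pertThr n N kδ ≤ 9 / 128 * U / N := by
    have h3 : (2 * perThr n N kδ + pertThr n N kδ) * pertThr n N kδ ≤ 3 * (perThr n N kδ * pertThr n N kδ) := by
      have := mul_le_mul_of_nonneg_right hZP hZ.le
      nlinarith only [this]
    have htk := H.t_cube_kδ_le
    calc (2 * perThr n N kδ + pertThr n N kδ) * pertThr n N kδ ≤ 3 * (512 * gramTol N * (n : ℝ) ^ 3 * markovW n N kδ) := by rw [← hPZ]; exact h3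
      _ ≤ 3 * (512 * gramTol N * (n : ℝ) ^ 3 * (3 * kδ * U)) := by gcongr
      _ = 4608 * (gramTol N * (n : ℝ) ^ 3 * kδ) * U := by ring
      _ ≤ 4608 * (1 / (65536 * (N : ℝ))) * U := by gcongr
      _ = 9 / 128 * U / N := by field_simp; ring
  have hUN : 0 < U * N := by positivity
  have hA' : (2 * perThr n N kδ + pertThr n N kδ) * pertThr n N kδ ≤ U / (8 * N) := by
    refine hA.trans ?_
    rw [div_le_div_iff₀ (by positivity) (by positivity)]
    nlinarith only [hUN]
  -- B: `(P² + A)/kη ≤ (48 N U + U N)/(512 N²) = (49/512) U/N`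
  have hB' : (perThr n N kδ ^ 2 + (2 * perThr n N kδ + pertThr n N kδ) * pertThr n N kδ) / (hidH.kη N : ℕ) ≤ U / (8 * N) := by
    have hP2 : perThr n N kδ ^ 2 ≤ 48 * N * U := by
      rw [H.Pr_sq]
      calc 16 * markovW n N kδ ≤ 16 * (3 * kδ * U) := by gcongr
        _ = 48 * kδ * U := by ring
        _ ≤ 48 * N * U := by gcongr
    have hA2 : (2 * perThr n N kδ + pertThr n N kδ) * pertThr n N kδ ≤ N * U := by
      refine hA.trans ?_
      rw [div_le_iff₀ (by positivity)]
      have : U ≤ N * U * N := by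
        calc U = 1 * U * 1 := by ring
          _ ≤ N * U * N := by gcongr
      nlinarith only [this, hU0]
    rw [hkη, div_le_div_iff₀ (by positivity) (by positivity)]
    calc (perThr n N kδ ^ 2 + (2 * perThr n N kδ + pertThr n N kδ) * pertThr n N kδ) * (8 * N) ≤ (48 * N * U + N * U) * (8 * N) := by gcongr
      _ = 392 * ((N : ℝ) ^ 2 * U) := by ring
      _ ≤ 512 * ((N : ℝ) ^ 2 * U) := by gcongr; norm_num
      _ = U * (512 * (N : ℝ) ^ 2) := by ring
  -- C: `n!((1+t) m s)ⁿ θ₂ (1+1/kη) ≤ (0.76) U/N`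
  have hC' : n.factorial * (((1 + gramTol N) * (((hidH.m N : ℕ) : ℝ) * entryMoment N)) ^ n * (oracleEps N / 2 / ((hidH.m N : ℕ) : ℝ) ^ n)) *
      (1 + 1 / (hidH.kη N : ℕ)) ≤ U / (8 * N) := by
    have h1t := H.one_add_t_pow_le
    have hkη1 : 1 + 1 / ((hidH.kη N : ℕ) : ℝ) ≤ 513 / 512 := by
      rw [hkη]
      have : 1 / (512 * (N : ℝ) ^ 2) ≤ 1 / 512 := div_le_div_of_nonneg_left (by norm_num) (by norm_num) (by nlinarith only [hN])
      linarith only [this]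
    have hkη0 : 0 ≤ 1 + 1 / ((hidH.kη N : ℕ) : ℝ) := by rw [hkη]; positivity
    have hMn : (0 : ℝ) < ((hidH.m N : ℕ) : ℝ) ^ n := by positivity
    have hε : 0 < oracleEps N := by unfold oracleEps; positivity
    have hrw : ((1 + gramTol N) * (((hidH.m N : ℕ) : ℝ) * entryMoment N)) ^ n * (oracleEps N / 2 / ((hidH.m N : ℕ) : ℝ) ^ n) =
        (1 + gramTol N) ^ n * entryMoment N ^ n * (oracleEps N / 2) := by
      rw [mul_pow, mul_pow]; field_simp
    have hX : ((1 + gramTol N) * (((hidH.m N : ℕ) : ℝ) * entryMoment N)) ^ n * (oracleEps N / 2 / ((hidH.m N : ℕ) : ℝ) ^ n) ≤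
        2 * (3 * 4 ^ ((sP N).b * n)) * (oracleEps N / 2) := by
      rw [hrw]
      have := mul_le_mul h1t hsn (pow_nonneg hs.le n) (by norm_num)
      exact mul_le_mul_of_nonneg_right this (by positivity)
    have hX0 : 0 ≤ ((1 + gramTol N) * (((hidH.m N : ℕ) : ℝ) * entryMoment N)) ^ n * (oracleEps N / 2 / ((hidH.m N : ℕ) : ℝ) ^ n) := by
      rw [hrw]; positivity
    calc n.factorial * (((1 + gramTol N) * (((hidH.m N : ℕ) : ℝ) * entryMoment N)) ^ n * (oracleEps N / 2 / ((hidH.m N : ℕ) : ℝ) ^ n)) *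
          (1 + 1 / ((hidH.kη N : ℕ) : ℝ))
        ≤ n.factorial * (2 * (3 * 4 ^ ((sP N).b * n)) * (oracleEps N / 2)) * (513 / 512) :=
          mul_le_mul (mul_le_mul_of_nonneg_left hX hnf.le) hkη1 hkη0 (by positivity)
      _ = (3 * 513 / 512) * oracleEps N * U := by rw [hU]; ring
      _ = (3 * 513 / (512 * 32)) * U / N := by unfold oracleEps; field_simp
      _ ≤ U / (8 * N) := by
          rw [div_le_div_iff₀ (by positivity) (by positivity)]
          nlinarith only [hUN]
  -- D: `1/4^b ≤ n!/(8N)`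
  have hD' : 1 / (4 : ℝ) ^ (sP N).b ≤ (n.factorial : ℝ) / (8 * N) := by
    have hb := sP_two_pow_b_ge N
    have h24 : (2 : ℝ) ^ (sP N).b ≤ 4 ^ (sP N).b := pow_le_pow_left₀ (by norm_num) (by norm_num) _
    rw [div_le_div_iff₀ h4b (by positivity), one_mul]
    calc 8 * (N : ℝ) ≤ 512 * (N : ℝ) ^ 2 * (N + 1) := by nlinarith only [hN]
      _ ≤ 4 ^ (sP N).b := hb.trans h24
      _ ≤ n.factorial * 4 ^ (sP N).b := le_mul_of_one_le_left h4b.le hnf1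
  -- assemble: `errTerm = (A + B + C)/4^{bn} + D`
  have hU' : U / (8 * N) / 4 ^ ((sP N).b * n) = (n.factorial : ℝ) / (8 * N) := by
    rw [hU]; field_simp
  have hC'' : n.factorial * ((1 + gramTol N) * (((hidH.m N : ℕ) : ℝ) * entryMoment N)) ^ n * (oracleEps N / 2 / ((hidH.m N : ℕ) : ℝ) ^ n) *
      (1 + 1 / (hidH.kη N : ℕ)) ≤ U / (8 * N) := by rw [mul_assoc (n.factorial : ℝ)]; exact hC'
  have hABC : ((2 * perThr n N kδ + pertThr n N kδ) * pertThr n N kδ +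
      (perThr n N kδ ^ 2 + (2 * perThr n N kδ + pertThr n N kδ) * pertThr n N kδ) / (hidH.kη N : ℕ) +
      n.factorial * ((1 + gramTol N) * (((hidH.m N : ℕ) : ℝ) * entryMoment N)) ^ n * (oracleEps N / 2 / ((hidH.m N : ℕ) : ℝ) ^ n) *
        (1 + 1 / (hidH.kη N : ℕ))) / 4 ^ ((sP N).b * n) ≤ 3 * ((n.factorial : ℝ) / (8 * N)) := by
    calc _ ≤ (3 * (U / (8 * N))) / 4 ^ ((sP N).b * n) := div_le_div_of_nonneg_right (by linarith) h4bn.le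
      _ = 3 * (U / (8 * N) / 4 ^ ((sP N).b * n)) := by ring
      _ = 3 * ((n.factorial : ℝ) / (8 * N)) := by rw [hU']
  unfold errTerm
  have hsV : (2 * 4 ^ (sP N).b * (sP N).v) = entryMoment N := rfl
  rw [hsV]
  have hunit : (n.factorial : ℝ) / (8 * N) ≤ (n.factorial : ℝ) / (8 * kε) :=
    div_le_div_of_nonneg_left (by positivity) (by positivity) (by linarith only [hkεN])
  calc _ ≤ 3 * ((n.factorial : ℝ) / (8 * N)) + (n.factorial : ℝ) / (8 * N) := add_le_add hABC hD'
    _ = 4 * ((n.factorial : ℝ) / (8 * N)) := by ring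
    _ ≤ 4 * ((n.factorial : ℝ) / (8 * kε)) := by linarith only [hunit]
    _ = (n.factorial : ℝ) / (2 * kε) := by rw [mul_div_assoc', div_eq_div_iff (by positivity) (by positivity)]; ring

/-! ### The oracle's accuracy -/

/-- **`1/kβ ≤ ε₀δ₀/24`** (`kβ = 4096N²`, `ε₀ = 1/(32N)`, `δ₀ = 1/(4kδ)`). [folklore] -/
theorem inv_kβ_le : 1 / ((hidH.kβ N : ℕ) : ℝ) ≤ oracleEps N * oracleDelta kδ / 24 := by
  have hN := H.N_real
  have hkδ := H.kδ_real
  have hkδN := H.kδ_le_N_real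
  rw [hidH_kβ]; push_cast
  unfold oracleEps oracleDelta
  rw [div_mul_div_comm, one_mul, div_div, div_le_div_iff₀ (by positivity) (by positivity), one_mul, one_mul]
  have := mul_le_mul_of_nonneg_left hkδN (by positivity : (0 : ℝ) ≤ N)
  nlinarith only [this, hN]

/-- `0 < ε₀`, `0 ≤ δ₀`. [folklore] -/
theorem ε₀_pos : 0 < oracleEps N ∧ 0 ≤ oracleDelta kδ := by
  unfold oracleEps oracleDelta; have := H.N_real; have := H.kδ_real
  exact ⟨by positivity, by positivity⟩

/-! ### The real-side tails and the rounding of the permanent -/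

/-- **The entry tail**: `n² · 2e^{-(2N)²/2} ≤ δ/16` (`N ≥ 3`). [folklore] -/
theorem entry_tail_le : (n : ℝ) ^ 2 * (2 * exp (-((2 * (N : ℝ)) ^ 2 / 2))) ≤ 1 / (16 * (kδ : ℝ)) := by
  have hN3 : (3 : ℝ) ≤ N := by have := H.three_le_N; exact_mod_cast this
  have hkδ := H.kδ_real
  have hkδN := H.kδ_le_N_real
  have hnN := H.n_le_N_real
  have hn0 := H.n_pos_real
  -- `e^{2N²} ≥ 32 N³ ≥ 32 n² kδ`
  have hexp : 32 * (N : ℝ) ^ 3 ≤ exp (2 * (N : ℝ) ^ 2) := by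
    have h1 := thirtytwo_mul_sq_le_exp N
    have h2 : (N : ℝ) ≤ exp N := by have := Real.add_one_le_exp (N : ℝ); linarith only [this]
    have h3 : exp (2 * N + 4) * exp N ≤ exp (2 * (N : ℝ) ^ 2) := by
      rw [← Real.exp_add]; exact Real.exp_le_exp.2 (by nlinarith only [hN3])
    calc 32 * (N : ℝ) ^ 3 = 32 * (N : ℝ) ^ 2 * N := by ring
      _ ≤ exp (2 * N + 4) * exp N := mul_le_mul h1 h2 (by positivity) (Real.exp_pos _).le
      _ ≤ exp (2 * (N : ℝ) ^ 2) := h3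
  rw [show -((2 * (N : ℝ)) ^ 2 / 2) = -(2 * (N : ℝ) ^ 2) by ring, Real.exp_neg]
  rw [show (n : ℝ) ^ 2 * (2 * (exp (2 * (N : ℝ) ^ 2))⁻¹) = 2 * (n : ℝ) ^ 2 / exp (2 * (N : ℝ) ^ 2) by ring,
    div_le_div_iff₀ (Real.exp_pos _) (by positivity)]
  have : (n : ℝ) ^ 2 * kδ ≤ (N : ℝ) ^ 3 := by
    have hsq : (n : ℝ) ^ 2 ≤ (N : ℝ) ^ 2 := by gcongr
    calc (n : ℝ) ^ 2 * kδ ≤ (N : ℝ) ^ 2 * N := mul_le_mul hsq hkδN (by positivity) (by positivity)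
      _ = (N : ℝ) ^ 3 := by ring
  linarith only [this, hexp]

/-- **The range tail**: `n² · 2e^{-((T-1)/2ᵇ)²/2} ≤ δ/16` (`(T-1)/2ᵇ = R - h ≥ R - 1`, `R > 16`,
`e^{2R} ≥ 32N³ + 1`). [folklore] -/
theorem range_tail_le : (n : ℝ) ^ 2 * (2 * exp (-(((((sP N).T : ℝ) - 1) / 2 ^ (sP N).b) ^ 2 / 2))) ≤ 1 / (16 * (kδ : ℝ)) := by
  have hkδ := H.kδ_real
  have hkδN := H.kδ_le_N_real
  have hnN := H.n_le_N_real
  have hn0 := H.n_pos_real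
  have hN := H.N_real
  have hR := sP_R_gt (show 1 ≤ N by have := H.three_le_N; omega)
  have hTh : (((sP N).T : ℝ) - 1) / 2 ^ (sP N).b = (sP N).R - (sP N).h := by
    have h := (sP N).T_mul_h
    unfold PGParams.h at h ⊢
    rw [sub_div, div_eq_mul_inv, h, one_div]
  have hh1 : (sP N).h ≤ 1 := (sP N).h_le_one
  have hexpo : -(((((sP N).T : ℝ) - 1) / 2 ^ (sP N).b) ^ 2 / 2) ≤ -(2 * (sP N).R) := by
    rw [hTh]
    have hh0 : 0 < (sP N).h := (sP N).h_pos
    nlinarith only [hR, hh1, hh0]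
  have hexp := le_exp_two_R N
  calc (n : ℝ) ^ 2 * (2 * exp (-(((((sP N).T : ℝ) - 1) / 2 ^ (sP N).b) ^ 2 / 2)))
      ≤ (n : ℝ) ^ 2 * (2 * exp (-(2 * (sP N).R))) := by gcongr
    _ = 2 * (n : ℝ) ^ 2 / exp (2 * (sP N).R) := by rw [Real.exp_neg]; ring
    _ ≤ 1 / (16 * (kδ : ℝ)) := by
        rw [div_le_div_iff₀ (Real.exp_pos _) (by positivity)]
        have : (n : ℝ) ^ 2 * kδ ≤ (N : ℝ) ^ 3 := by
          have hsq : (n : ℝ) ^ 2 ≤ (N : ℝ) ^ 2 := by gcongr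
          calc (n : ℝ) ^ 2 * kδ ≤ (N : ℝ) ^ 2 * N := mul_le_mul hsq hkδN (by positivity) (by positivity)
            _ = (N : ℝ) ^ 3 := by ring
        linarith only [this, hexp]

/-- **The rounding of the permanent**: `2n(n!)²(2N+1)^{2n} 2^{-b} ≤ n!/(2kε)` (`2ᵇ ≥ 4N²9ᴺN^{3N}`).
[cite: AaronsonArkhipovToC2013, §2 (p. 161)] -/
theorem rounding_le : 2 * n * ((n.factorial : ℝ)) ^ 2 * ((2 * (N : ℝ)) + 1) ^ (2 * n) * ((2 : ℝ) ^ (sP N).b)⁻¹ ≤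
    (n.factorial : ℝ) / (2 * kε) := by
  have hnat : 4 * kε * n * n.factorial * (2 * N + 1) ^ (2 * n) ≤ 2 ^ (sP N).b := by
    have hn := H.hn; have hN : 1 ≤ N := (show 1 ≤ N by have := H.three_le_N; omega); have hnN := H.n_le_N; have hkε := H.kε_le_N
    have h1 : n.factorial ≤ N ^ N := (Nat.factorial_le_pow n).trans
      ((Nat.pow_le_pow_left hnN n).trans (Nat.pow_le_pow_right hN hnN))
    have h2 : (2 * N + 1) ^ (2 * n) ≤ (3 * N) ^ (2 * N) :=
      (Nat.pow_le_pow_left (by omega) _).trans (Nat.pow_le_pow_right (by omega) (by omega))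
    calc 4 * kε * n * n.factorial * (2 * N + 1) ^ (2 * n) ≤ 4 * N * N * N ^ N * (3 * N) ^ (2 * N) := by
          gcongr
      _ = 4 * N ^ 2 * 9 ^ N * N ^ (3 * N) := by
          rw [mul_pow, pow_mul, show (3 : ℕ) ^ 2 = 9 by norm_num, pow_mul]
          ring_nf
      _ ≤ 2 ^ (sP N).b := two_pow_precP_ge' N
  have hreal : 4 * (kε : ℝ) * n * n.factorial * (2 * N + 1) ^ (2 * n) ≤ (2 : ℝ) ^ (sP N).b := by exact_mod_cast hnat
  have hkε := H.kε_real
  have h2b : (0 : ℝ) < 2 ^ (sP N).b := by positivity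
  rw [← div_eq_mul_inv, div_le_div_iff₀ h2b (by positivity)]
  have hnf : (0 : ℝ) < n.factorial := by exact_mod_cast Nat.factorial_pos n
  calc 2 * n * (n.factorial : ℝ) ^ 2 * (2 * N + 1) ^ (2 * n) * (2 * kε)
      = n.factorial * (4 * (kε : ℝ) * n * n.factorial * (2 * N + 1) ^ (2 * n)) := by ring
    _ ≤ n.factorial * (2 : ℝ) ^ (sP N).b := mul_le_mul_of_nonneg_left hreal hnf.le

end HidingHyp

end Literature.Computability.QuantumComplexity
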